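import Summits.ValiantsHypothesis.ValiantsHypothesis.Theorems.LacunarySymmetroidMatrixDescartesCensusTNC97NegL
import Summits.ValiantsHypothesis.ValiantsHypothesis.Theorems.LacunarySymmetroidMatrixDescartesCensusTNC97NegS

/-!
# `MatrixDescartes` census — T-NC kernel certificate for `d = (0, 7, 12, 15, 16, 97)`, part 4: the table line `ζ(2,6; d) ≤ 19`

HONEST FRAMING.  Object-search cell `pub-symmetroid`, crux `Theses.LacunarySymmetroid.MatrixDescartes`
(stmt-ValiantsHypothesis-18050).  Generated by the typer's `tools/gen_tnc_nodes.py` from theory g4's exact LP certificate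
`nclaw/cert_2-6_0-7-12-15-16-97.json` (T-NC-LP-CERT.md §2–3; referee g18 third check TNC-REF-g18.md).  On this support — one of the
four carrying the census record `(2,6) = 18` — NO real symmetric `2 × 2` pencil has `20 = D(2,6)` distinct positive roots
(`posRoots_le_19_on_2_6_0_7_12_15_16_97`, part 3).  Ingredients, all kernel theorems of the tree: full support + sign
alternation (F1) and the 19 adjacent Newton-cone rows (C25) from part 1 (`tnc_rows_97`); the Lorentz rows P (reverse
Cauchy–Schwarz) and T (Gram bound through a definite letter: `trow_*` with `gram_master_identity`); and, per node of the
certificate's branch tree, the FARKAS PRODUCT of the rows raised to the certificate's integer multipliers: the coefficient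
atoms cancel identically (`ring`) and the remaining integer inequality between gap-weight products is refuted by
`decide +kernel`.  Case `s = +` (word DIIDDD, part 2) needs one node; case `s = −` (word IDDIII, part 3) branches on
two definite–indefinite legs (4 nodes).  This certifies ONE table line of DATA-CUT item (b) at the magnitude level; it
says nothing about `V = 19`, about `ζ_sym(2,6)` globally, about the crux, or about `VP ≠ VNP`.

[folklore] Kernel replay of the cell's exact LP certificate; elementary.
-/

-- `Summit.ValiantsHypothesis.ValiantsHypothesis.…` repeats a component by the D-0017 layout
-- (single-conjunct summit), which the `dupNamespace` linter flags; the name is mandated.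
set_option linter.dupNamespace false

namespace Summit.ValiantsHypothesis.ValiantsHypothesis.Theorems.LacunarySymmetroidMatrixDescartes.Census

open Polynomial Finset
open scoped BigOperators Polynomial Matrix

/-- Case `s = −` of the T-NC certificate on `d = (0, 7, 12, 15, 16, 97)`, assembled from the two halves of its first branch leg (0, 1). [folklore] -/
theorem tnc_neg_97 (S : Fin 6 → Matrix (Fin 2) (Fin 2) ℝ) (hS : ∀ l, (S l).IsSymm)
    (hZ : 20 ≤ ((∑ l, ((X : ℝ[X]) ^ (![0, 7, 12, 15, 16, 97] : Fin 6 → ℕ) l) • (S l).map C).det.roots.toFinset.filter (fun t => 0 < t)).card)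
    (hq0 : (S 0 0 0 * S 0 1 1 - S 0 0 1 ^ 2) < 0) : False := by
  rcases le_total ((4 : ℝ) * |(S 0 0 0 * S 0 1 1 - S 0 0 1 ^ 2)| * (S 1 0 0 * S 1 1 1 - S 1 0 1 ^ 2)) (|(S 0 0 0 * S 1 1 1 + S 0 1 1 * S 1 0 0 - 2 * (S 0 0 1 * S 1 0 1))| ^ 2) with h | h
  · exact tnc_neg_97_long S hS hZ h hq0
  · exact tnc_neg_97_short S hS hZ h hq0

/-- **Table line (kernel, magnitude level): `ζ(2,6; (0, 7, 12, 15, 16, 97)) ≤ 19 < 20 = D(2,6)`** — no real symmetric `2 × 2`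
pencil on this support is Descartes-sharp (T-NC certificate, both global signs). [folklore] -/
theorem posRoots_le_19_on_2_6_0_7_12_15_16_97 (S : Fin 6 → Matrix (Fin 2) (Fin 2) ℝ) (hS : ∀ l, (S l).IsSymm) :
    ((∑ l, ((X : ℝ[X]) ^ (![0, 7, 12, 15, 16, 97] : Fin 6 → ℕ) l) • (S l).map C).det.roots.toFinset.filter (fun t => 0 < t)).card ≤ 19 := by
  by_contra hcon
  have hZ : 20 ≤ ((∑ l, ((X : ℝ[X]) ^ (![0, 7, 12, 15, 16, 97] : Fin 6 → ℕ) l) • (S l).map C).det.roots.toFinset.filter (fun t => 0 < t)).card := by omega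
  have nz0 := (tnc_rows_97 S hS hZ).1
  rcases lt_or_gt_of_ne nz0 with hneg | hpos
  · exact tnc_neg_97 S hS hZ hneg
  · exact tnc_pos_97 S hS hZ hpos

end Summit.ValiantsHypothesis.ValiantsHypothesis.Theorems.LacunarySymmetroidMatrixDescartes.Census
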